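import Literature.AlgebraicGeometry.Resolution.ImmediateRationalUniformization
import Literature.AlgebraicGeometry.Resolution.HenselRootsAmbient
import HarnessLib

/-!
# Approximating an immediate element of transcendental approximation type from `K(y)^h` (Kuhlmann–Vlahu 2014, Lemma 10.4 with `h = 1`)

Topic: `Literature/AlgebraicGeometry/Resolution` (valued function fields). PROVED valuation
theory for the discharge of the hypothesis `(hKV)` of
`Kuhlmann2019_Prop52_sepClosed.of_degreeP_steps` (`Kuhlmann2019Prop52Reduction.lean`) =
F.-V. Kuhlmann, I. Vlahu, *The relative approximation degree in valued function fields*, Math.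
Z. 276 (2014) 203–235 = arXiv:1304.0200, **Thm. 11.1** ("Take a valued field `(K,v)` of
rank 1 and an immediate function field `(F|K,v)` of transcendence degree 1. Suppose there is
some `x ∈ F^h ∖ K^c` with transcendental approximation type over `K` such that `F^h = K(x)^h`.
Then there is already some `y ∈ F` such that `F^h = K(y)^h`. In fact, there is some
`γ ∈ vK` such that `K(x)^h = K(y)^h` holds for every `y ∈ F` with `v(x-y) ≥ γ`"), whose proof
rests on the degree bound `[K(x)^h : K(y)^h] ≤ 𝐡_K(x:y)` (Thm. 10.7, Prop. 10.5) obtained from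
Lemma 10.4 and Krasner's lemma. In the application `v(x - y) > dist(x, K)`, so that the
relative approximation degree `𝐡_K(x:y)` is `1` and Lemma 10.4 (p. 20: "`F°(Z) := (d^𝐡/f_𝐡(c))
(f̃(Z) - y) ∈ O_{K(y)}[Z]` … admits a factorization `F° = G°H°` over `K(y)^h` with
`G°v = Z^𝐡 - (x₀v)^𝐡` … `v(x - (d⁻¹ z_{j₀} + c)) ≥ (1/𝐡)(v(y - f(x)) - β_K(x:f))`") becomes
Hensel's Lemma for a polynomial whose reduction is LINEAR. This file proves that case
directly, without the apparatus of approximation types and degrees: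

* `valuation_le_valuation_sum_of_pairwise_ne` — ultrametric bookkeeping: if the non-zero terms
  of a finite sum have pairwise distinct values, each term is bounded by the sum.
* `exists_mem_valuation_sub_le_of_taylor` — **the Newton step**. Let `K ≤ L ≤ Ω` with `L`
  henselian, `(K(x)|K, v)` immediate with `x ∉ K` of transcendental approximation type
  (condition (3) of Knaf–Kuhlmann 2009, Lemma 2.17, the hypothesis `h3`), `y ∈ L` closer to `x`
  than every element of `K`, and `f ∈ K[X]` with `f(x)` closer to `y` than every `v(x - c)`,
  `c ∈ K`. Then some `ℓ ∈ L` has `v(x - ℓ) ≤ v(f(x) - y)`. Proof: at a centre `c ∈ K` where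
  the Taylor terms of `f - X` have pairwise distinct values (Knaf–Kuhlmann 2009, Lemma 2.18,
  `exists_center_taylor_valuation_ne`), all of them are bounded by `v(f(x) - x) < v(x - c)`:
  the linear Taylor coefficient `f₁(c)` of `f` is a `1`-unit and the higher terms
  `f_i(c)(x-c)^i` are `< v(x - c)`; with `b ∈ K`, `v(b) = v(x - c)`, `x̃ = (x-c)/b`, the
  polynomial `F°(Z) = (∑ f_i(c) bⁱ Zⁱ - y)/(f₁(c) b)` over `O_L` has unit constant term, linear
  coefficient `1` and higher coefficients in the maximal ideal; its reversed polynomial is monic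
  with a simple residue root, so Hensel's Lemma (`exists_root_of_isHenselianField`) gives a root
  `ζ ∈ O_L^×` of `F°` with `v(x̃ - ζ) = v(F°(x̃)) = v(f(x) - y)/v(b)`, and `ℓ = c + bζ`.

Everything is PROVED; no definitions, no named facts.

## Sources

* F.-V. Kuhlmann, I. Vlahu, Math. Z. 276 (2014) = arXiv:1304.0200: §9 (proof of Thm. 9.1),
  §10 (Lemma 10.4, Prop. 10.5), §11 (Thm. 11.1).
* H. Knaf, F.-V. Kuhlmann, Adv. Math. 221 (2009) = arXiv:math/0702856: Lemmas 2.17–2.18.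
  [KnafKuhlmann2009]

## Rendering notes

As in `ImmediateRationalUniformization.lean` / `KnafKuhlmann2009Lemma216.lean`: `(Ω, V)` one
valued field, `K : Subfield Ω`, "`K(x)|K` immediate" = `hval`, `hres`, transcendental
approximation type = `h3`; `L` henselian = `IsHenselianField L (V ∩ L)` (`Henselization.lean`);
values multiplicative.
-/

noncomputable section

open IsLocalRing Polynomial Finset

namespace Literature.AlgebraicGeometry.Resolution

universe u

variable {Ω : Type u} [Field Ω] (V : ValuationSubring Ω)

/-! ### Ultrametric bookkeeping -/

/-- If the non-zero terms of a finite sum have pairwise distinct values, then every term is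
bounded by the sum, and a non-zero sum has the value of one of its terms. [folklore] -/
theorem valuation_le_valuation_sum_of_pairwise_ne {ι : Type*} [DecidableEq ι] (s : Finset ι)
    (g : ι → Ω)
    (h : ∀ i ∈ s, ∀ j ∈ s, i ≠ j → g i ≠ 0 → g j ≠ 0 → V.valuation (g i) ≠ V.valuation (g j)) :
    (∀ i ∈ s, V.valuation (g i) ≤ V.valuation (∑ j ∈ s, g j)) ∧
      (∑ j ∈ s, g j ≠ 0 → ∃ i ∈ s, g i ≠ 0 ∧ V.valuation (∑ j ∈ s, g j) = V.valuation (g i)) := by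
  induction s using Finset.induction_on with
  | empty => simp
  | insert a s ha ih =>
    have h' : ∀ i ∈ s, ∀ j ∈ s, i ≠ j → g i ≠ 0 → g j ≠ 0 →
        V.valuation (g i) ≠ V.valuation (g j) := fun i hi j hj =>
      h i (mem_insert_of_mem hi) j (mem_insert_of_mem hj)
    obtain ⟨ih1, ih2⟩ := ih h'
    rw [sum_insert ha]
    by_cases hga : g a = 0
    · rw [hga, zero_add]
      refine ⟨fun i hi => ?_, fun hne => ?_⟩
      · rcases mem_insert.mp hi with rfl | hi
        · rw [hga, map_zero]; exact zero_le
        · exact ih1 i hi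
      · obtain ⟨i, hi, hgi, hv⟩ := ih2 hne
        exact ⟨i, mem_insert_of_mem hi, hgi, hv⟩
    by_cases hs0 : ∑ j ∈ s, g j = 0
    · have hall : ∀ i ∈ s, g i = 0 := fun i hi => by
        have := ih1 i hi
        rw [hs0, map_zero, le_zero_iff, map_eq_zero] at this
        exact this
      rw [hs0, add_zero]
      refine ⟨fun i hi => ?_, fun hne => ⟨a, mem_insert_self a s, hga, rfl⟩⟩
      rcases mem_insert.mp hi with rfl | hi
      · exact le_rfl
      · rw [hall i hi, map_zero]; exact zero_le
    · obtain ⟨j, hj, hgj, hvj⟩ := ih2 hs0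
      have hne : V.valuation (g a) ≠ V.valuation (∑ j ∈ s, g j) := by
        rw [hvj]
        exact h a (mem_insert_self a s) j (mem_insert_of_mem hj) (fun e => ha (e ▸ hj)) hga hgj
      have hmax := Valuation.map_add_of_distinct_val V.valuation hne
      refine ⟨fun i hi => ?_, fun _ => ?_⟩
      · rw [hmax]
        rcases mem_insert.mp hi with rfl | hi
        · exact le_max_left _ _
        · exact le_trans (ih1 i hi) (le_max_right _ _)
      · rw [hmax]
        rcases le_total (V.valuation (g a)) (V.valuation (∑ j ∈ s, g j)) with hle | hle
        · rw [max_eq_right hle, hvj]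
          exact ⟨j, mem_insert_of_mem hj, hgj, rfl⟩
        · rw [max_eq_left hle]
          exact ⟨a, mem_insert_self a s, hga, rfl⟩

/-- The value of a polynomial all of whose coefficients have value `< 1`, at a point of `V`,
is `< 1`. [folklore] -/
theorem valuation_eval_lt_one_of_coeff {p : Polynomial Ω}
    (hp : ∀ k, V.valuation (p.coeff k) < 1) {w : Ω} (hw : w ∈ V) : V.valuation (p.eval w) < 1 := by
  rw [eval_eq_sum_range]
  refine Valuation.map_sum_lt _ one_ne_zero fun k _ => ?_
  rw [map_mul, map_pow]
  calc V.valuation (p.coeff k) * V.valuation w ^ k ≤ V.valuation (p.coeff k) * 1 :=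
        mul_le_mul' le_rfl (pow_le_one' ((V.valuation_le_one_iff w).mpr hw) k)
    _ < 1 := by rw [mul_one]; exact hp k

/-! ### The Newton step -/

/-- **Kuhlmann–Vlahu 2014, Lemma 10.4 in relative approximation degree `1`.** Let
`K ≤ L ≤ Ω`, `(L, V ∩ L)` henselian, `(K(x)|K, v)` immediate with `x ∉ K` of transcendental
approximation type, `y ∈ L` with `v(x - y) < v(x - c)` for all `c ∈ K` (multiplicative
values: `y` is closer to `x` than `K` is), and `f` a polynomial over `K` with
`v(f(x) - y) < v(x - c)` for all `c ∈ K`. Then `v(x - ℓ) ≤ v(f(x) - y)` for some `ℓ ∈ L`.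
[folklore] -/
theorem exists_mem_valuation_sub_le_of_taylor (K : Subfield Ω) {x : Ω} (hxK : x ∉ K)
    (hval : ∀ w ∈ Subfield.closure ((K : Set Ω) ∪ {x}), w ≠ 0 → ∃ b ∈ K,
      V.valuation w = V.valuation b)
    (hres : ∀ w ∈ Subfield.closure ((K : Set Ω) ∪ {x}), w ∈ V → ∃ c ∈ K,
      V.valuation (w - c) < 1)
    (h3 : ∀ g : Polynomial Ω, (∀ k, g.coeff k ∈ K) → ∃ a₀ ∈ K, ∃ α : V.ValueGroup,
      ∀ a ∈ K, V.valuation (x - a) ≤ V.valuation (x - a₀) → V.valuation (g.eval a) = α)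
    {L : Subfield Ω} (hL : IsHenselianField L (V.comap (algebraMap L Ω))) (hKL : K ≤ L)
    {y : Ω} (hyL : y ∈ L) (hy : ∀ c ∈ K, V.valuation (x - y) < V.valuation (x - c))
    {f : Polynomial Ω} (hf : ∀ k, f.coeff k ∈ K)
    (hfy : ∀ c ∈ K, V.valuation (f.eval x - y) < V.valuation (x - c)) :
    ∃ ℓ ∈ L, V.valuation (x - ℓ) ≤ V.valuation (f.eval x - y) := by
  classical
  /- Step 0: `f` is not constant. -/
  have hN : 0 < f.natDegree := by
    by_contra h0
    have h0' : f.natDegree = 0 := Nat.eq_zero_of_not_pos h0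
    obtain ⟨f₀, hf₀⟩ := Polynomial.natDegree_eq_zero.mp h0'
    have hf₀K : f₀ ∈ K := by have := hf 0; rwa [← hf₀, coeff_C_zero] at this
    have h1 := hfy f₀ hf₀K
    rw [← hf₀, eval_C] at h1
    have h2 := hy f₀ hf₀K
    have : V.valuation (x - f₀) < V.valuation (x - f₀) := by
      calc V.valuation (x - f₀) = V.valuation ((x - y) + -(f₀ - y)) := by ring_nf
        _ ≤ max (V.valuation (x - y)) (V.valuation (-(f₀ - y))) := Valuation.map_add _ _ _
        _ < V.valuation (x - f₀) := by rw [Valuation.map_neg]; exact max_lt h2 h1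
    exact lt_irrefl _ this
  set N := f.natDegree with hNdef
  /- Step 1: a good centre for `h = f - X`. -/
  set h : Polynomial Ω := f - X with hhdef
  have hhK : ∀ k, h.coeff k ∈ K := fun k => by
    rw [hhdef, coeff_sub, coeff_X]
    exact sub_mem (hf k) (by split_ifs <;> simp [K.one_mem, K.zero_mem])
  obtain ⟨c, hcK, b, hbK, hb0, hvb, hdist⟩ :=
    exists_center_taylor_valuation_ne V K hxK hval hres h3 {h} (by simpa using hhK)
  have hdist' := hdist h (mem_singleton_self h)
  have hvb0 : V.valuation b ≠ 0 := (_root_.map_ne_zero _).mpr hb0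
  have hvbpos : 0 < V.valuation b := zero_lt_iff.mpr hvb0
  -- `x̃ = (x - c)/b`, a unit
  obtain ⟨xt, hxt⟩ : ∃ xt : Ω, xt = (x - c) / b := ⟨_, rfl⟩
  have hxc : x - c = b * xt := by rw [hxt, mul_div_cancel₀ _ hb0]
  have hvxt : V.valuation xt = 1 := by rw [hxt, map_div₀, ← hvb, div_self hvb0]
  have hxtV : xt ∈ V := (V.valuation_le_one_iff _).mp hvxt.le
  /- Step 2: the Taylor terms of `h` at `c` are all `< v(b)`. -/
  obtain ⟨T, hT⟩ : ∃ T : ℕ → Ω, T = fun i => (taylor c h).coeff i * b ^ i := ⟨_, rfl⟩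
  have hTi : ∀ i, T i = (taylor c h).coeff i * b ^ i := fun i => by rw [hT]
  have hexp_h : h.eval x = ∑ i ∈ range (N + 1), T i * xt ^ i := by
    have h1 : h.eval x = (taylor c h).eval (x - c) := by rw [taylor_eval, sub_add_cancel]
    have hdeg : (taylor c h).natDegree ≤ N := by
      rw [natDegree_taylor, hhdef]
      refine (natDegree_sub_le _ _).trans ?_
      rw [natDegree_X]
      exact max_le le_rfl hN
    rw [h1, eval_eq_sum_range' (Nat.lt_succ_of_le hdeg)]
    refine sum_congr rfl fun i _ => ?_
    rw [hTi, hxc, mul_pow, ← mul_assoc]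
  have hvh : V.valuation (h.eval x) < V.valuation b := by
    have : h.eval x = (f.eval x - y) + (y - x) := by rw [hhdef, eval_sub, eval_X]; ring
    rw [this]
    refine lt_of_le_of_lt (Valuation.map_add _ _ _) (max_lt ?_ ?_)
    · rw [hvb]; exact hfy c hcK
    · rw [← Valuation.map_neg, neg_sub, hvb]; exact hy c hcK
  have hTle : ∀ i ∈ range (N + 1), V.valuation (T i * xt ^ i) ≤ V.valuation (h.eval x) := by
    rw [hexp_h]
    refine (valuation_le_valuation_sum_of_pairwise_ne V (range (N + 1)) (fun i => T i * xt ^ i)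
      fun i _ j _ hij hi hj => ?_).1
    have hi' : T i ≠ 0 := fun h0 => hi (by rw [h0, zero_mul])
    have hj' : T j ≠ 0 := fun h0 => hj (by rw [h0, zero_mul])
    have e1 : V.valuation (T i * xt ^ i) = V.valuation (T i) := by
      rw [map_mul, map_pow, hvxt, one_pow, mul_one]
    have e2 : V.valuation (T j * xt ^ j) = V.valuation (T j) := by
      rw [map_mul, map_pow, hvxt, one_pow, mul_one]
    rw [e1, e2, hTi, hTi]
    rw [hTi] at hi' hj'
    exact hdist' i j hij hi' hj'
  have hTlt : ∀ i, i ≤ N → V.valuation (T i) < V.valuation b := by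
    intro i hi
    have := hTle i (mem_range.mpr (Nat.lt_succ_of_le hi))
    rw [map_mul, map_pow, hvxt, one_pow, mul_one] at this
    exact lt_of_le_of_lt this hvh
  /- Step 3: the Taylor coefficients of `f`: `f₁(c)` is a `1`-unit, higher terms are small. -/
  obtain ⟨t, ht⟩ : ∃ t : ℕ → Ω, t = fun i => (taylor c f).coeff i * b ^ i := ⟨_, rfl⟩
  have hti' : ∀ i, t i = (taylor c f).coeff i * b ^ i := fun i => by rw [ht]
  have htK : ∀ i, t i ∈ K := fun i => by
    rw [hti']; exact mul_mem (coeff_taylor_mem K hf hcK i) (pow_mem hbK i)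
  have ht0 : t 0 = f.eval c := by rw [hti', taylor_coeff_zero, pow_zero, mul_one]
  have hTt : ∀ i, 2 ≤ i → T i = t i := by
    intro i hi
    rw [hTi, hti', hhdef, map_sub, coeff_sub, taylor_X, coeff_add, coeff_X, coeff_C,
      if_neg (by omega), if_neg (by omega)]
    ring
  have hT1 : T 1 = t 1 - b := by
    rw [hTi, hti', hhdef, map_sub, coeff_sub, taylor_X, coeff_add, coeff_X_one, coeff_C,
      if_neg one_ne_zero]
    ring
  -- `e = t 1 = f₁(c) b` has value `v(b)`
  obtain ⟨e, he⟩ : ∃ e : Ω, e = t 1 := ⟨_, rfl⟩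
  have hve : V.valuation e = V.valuation b := by
    have h1 : V.valuation (T 1) < V.valuation b := hTlt 1 hN
    rw [hT1, ← he] at h1
    exact Valuation.map_eq_of_sub_lt _ h1
  have he0 : e ≠ 0 := fun h0 => hvb0 (by rw [← hve, h0, map_zero])
  have hve0 : V.valuation e ≠ 0 := (_root_.map_ne_zero _).mpr he0
  have hti : ∀ i, 2 ≤ i → i ≤ N → V.valuation (t i) < V.valuation e := fun i hi hiN => by
    rw [hve, ← hTt i hi]; exact hTlt i hiN
  /- Step 4: the coefficients `a i` of `F°` and the value `F°(x̃)`. -/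
  obtain ⟨a, ha⟩ : ∃ a : ℕ → Ω, a = fun i => if i = 0 then (f.eval c - y) / e else t i / e :=
    ⟨_, rfl⟩
  have ha0 : a 0 = (f.eval c - y) / e := by rw [ha]; simp
  have hai : ∀ i, 1 ≤ i → a i = t i / e := fun i hi => by rw [ha]; simp [show i ≠ 0 by omega]
  have ha1 : a 1 = 1 := by rw [hai 1 le_rfl, ← he]; exact div_self he0
  have hasmall : ∀ i, 2 ≤ i → i ≤ N → V.valuation (a i) < 1 := fun i hi hiN => by
    rw [hai i (by omega), map_div₀, div_lt_one₀ (zero_lt_iff.mpr hve0)]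
    exact hti i hi hiN
  have heL : e ∈ L := by rw [he]; exact hKL (htK 1)
  have haL : ∀ i, a i ∈ L := fun i => by
    rcases Nat.eq_zero_or_pos i with rfl | hi
    · rw [ha0]
      refine div_mem (sub_mem (hKL ?_) hyL) heL
      rw [← ht0]; exact htK 0
    · rw [hai i hi]; exact div_mem (hKL (htK i)) heL
  -- Taylor expansion of `f`
  have hexp_f : f.eval x = ∑ i ∈ range (N + 1), t i * xt ^ i := by
    have h1 : f.eval x = (taylor c f).eval (x - c) := by rw [taylor_eval, sub_add_cancel]
    rw [h1, eval_eq_sum_range' (by rw [natDegree_taylor]; exact Nat.lt_succ_self _)]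
    refine sum_congr rfl fun i _ => ?_
    rw [hti', hxc, mul_pow, ← mul_assoc]
  have hsplit : ∀ s : ℕ → Ω, ∑ i ∈ range (N + 1), s i = s 0 + ∑ i ∈ Ico 1 (N + 1), s i :=
    fun s => by rw [range_eq_Ico, sum_eq_sum_Ico_succ_bot (Nat.succ_pos N)]
  -- `∑ a i x̃^i = (f(x) - y)/e`
  have hsumx : ∑ i ∈ range (N + 1), a i * xt ^ i = (f.eval x - y) / e := by
    rw [hsplit, hexp_f, hsplit (fun i => t i * xt ^ i), ht0, ha0, pow_zero, mul_one]
    have htail : ∑ i ∈ Ico 1 (N + 1), a i * xt ^ i =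
        (∑ i ∈ Ico 1 (N + 1), t i * xt ^ i) / e := by
      rw [div_eq_mul_inv, Finset.sum_mul]
      refine sum_congr rfl fun i hi => ?_
      rw [mem_Ico] at hi
      rw [hai i hi.1]
      ring
    rw [htail]
    field_simp
    ring
  /- Step 5: `a 0` is a unit. -/
  have hvfxc : V.valuation (f.eval x - f.eval c) = V.valuation e := by
    have hfxc : f.eval x - f.eval c = ∑ i ∈ Ico 1 (N + 1), t i * xt ^ i := by
      rw [hexp_f, hsplit (fun i => t i * xt ^ i), ht0, pow_zero, mul_one]
      ring
    rw [hfxc, sum_eq_sum_Ico_succ_bot (by omega : 1 < N + 1), pow_one, ← he]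
    have htail : V.valuation (∑ i ∈ Ico 2 (N + 1), t i * xt ^ i) < V.valuation (e * xt) := by
      rw [map_mul, hvxt, mul_one]
      refine Valuation.map_sum_lt _ hve0 fun i hi => ?_
      rw [mem_Ico] at hi
      rw [map_mul, map_pow, hvxt, one_pow, mul_one]
      exact hti i hi.1 (by omega)
    rw [Valuation.map_add_eq_of_lt_left _ htail, map_mul, hvxt, mul_one]
  have hva0 : V.valuation (a 0) = 1 := by
    have hid : f.eval c - y = -(f.eval x - f.eval c) + (f.eval x - y) := by ring
    have hv1 : V.valuation (f.eval x - y) < V.valuation (-(f.eval x - f.eval c)) := by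
      rw [Valuation.map_neg, hvfxc, hve, hvb]; exact hfy c hcK
    rw [ha0, map_div₀, hid, Valuation.map_add_eq_of_lt_left _ hv1, Valuation.map_neg, hvfxc,
      div_self hve0]
  have ha00 : a 0 ≠ 0 := fun h0 => by rw [h0, map_zero] at hva0; exact zero_ne_one hva0
  have haV : ∀ i, i ≤ N → a i ∈ V := by
    intro i hi
    rcases Nat.lt_or_ge i 2 with hlt | hge
    · interval_cases i
      · exact (V.valuation_le_one_iff _).mp hva0.le
      · rw [ha1]; exact V.one_mem
    · exact (V.valuation_le_one_iff _).mp (hasmall i hge hi).le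
  /- Step 6: the reversed polynomial `G`, monic over `O_L`, and its approximate root `w₀`. -/
  obtain ⟨w₀, hw₀⟩ : ∃ w₀ : Ω, w₀ = -(a 0)⁻¹ := ⟨_, rfl⟩
  have hvw₀ : V.valuation w₀ = 1 := by rw [hw₀, Valuation.map_neg, map_inv₀, hva0, inv_one]
  have hw₀V : w₀ ∈ V := (V.valuation_le_one_iff _).mp hvw₀.le
  have hw₀L : w₀ ∈ L := by rw [hw₀]; exact neg_mem (inv_mem (haL 0))
  -- coefficients `q i = a i / a 0`
  obtain ⟨q, hq⟩ : ∃ q : ℕ → Ω, q = fun i => a i / a 0 := ⟨_, rfl⟩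
  have hqi : ∀ i, q i = a i / a 0 := fun i => by rw [hq]
  have hqV : ∀ i, i ≤ N → q i ∈ V := fun i hi => by
    rw [hqi, ← V.valuation_le_one_iff, map_div₀, hva0, div_one]
    exact (V.valuation_le_one_iff _).mpr (haV i hi)
  have hqL : ∀ i, q i ∈ L := fun i => by rw [hqi]; exact div_mem (haL i) (haL 0)
  have hq1 : q 1 = -w₀ := by rw [hqi, ha1, hw₀, one_div, neg_neg]
  have hqsmall : ∀ i, 2 ≤ i → i ≤ N → V.valuation (q i) < 1 := fun i hi hiN => by
    rw [hqi, map_div₀, hva0, div_one]; exact hasmall i hi hiN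
  have haq : ∀ i, a 0 * q i = a i := fun i => by rw [hqi, mul_div_cancel₀ _ ha00]
  -- the tail `M` of `G` beyond its first two coefficients, and `G` itself
  set M : Polynomial Ω := ∑ i ∈ Ico 2 (N + 1), C (q i) * X ^ (N - i) with hM
  set G : Polynomial Ω := X ^ N + (C (q 1) * X ^ (N - 1) + M) with hG
  have hGsum : G = X ^ N + ∑ i ∈ Ico 1 (N + 1), C (q i) * X ^ (N - i) := by
    rw [hG, hM, sum_eq_sum_Ico_succ_bot (by omega : 1 < N + 1)]
  have hRsum : ∑ i ∈ Ico 1 (N + 1), C (q i) * X ^ (N - i) = C (q 1) * X ^ (N - 1) + M := by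
    rw [hM, sum_eq_sum_Ico_succ_bot (by omega : 1 < N + 1)]
  have hRdeg : (C (q 1) * X ^ (N - 1) + M).degree < (N : WithBot ℕ) := by
    rw [← hRsum]
    refine lt_of_le_of_lt (degree_sum_le _ _)
      ((Finset.sup_lt_iff (WithBot.bot_lt_coe N)).mpr fun i hi => ?_)
    rw [mem_Ico] at hi
    refine lt_of_le_of_lt (degree_C_mul_X_pow_le _ _) ?_
    exact WithBot.coe_lt_coe.mpr (Nat.sub_lt hN (by omega))
  have hGmon : G.Monic := by rw [hG]; exact monic_X_pow_add hRdeg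
  have hGcoeff : ∀ k, G.coeff k ∈ V ∧ G.coeff k ∈ L := by
    intro k
    rw [hGsum, coeff_add, coeff_X_pow, finsetSum_coeff]
    simp only [coeff_C_mul_X_pow]
    refine ⟨add_mem ?_ (sum_mem fun i hi => ?_), add_mem ?_ (sum_mem fun i hi => ?_)⟩
    · split_ifs <;> simp [V.one_mem, V.zero_mem]
    · rw [mem_Ico] at hi
      split_ifs
      · exact hqV i (by omega)
      · exact V.zero_mem
    · split_ifs <;> simp [L.one_mem, L.zero_mem]
    · split_ifs
      · exact hqL i
      · exact L.zero_mem
  -- `M` and `M'` are small at points of `V`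
  have hMcoeff : ∀ k, V.valuation (M.coeff k) < 1 := by
    intro k
    rw [hM, finsetSum_coeff]
    refine Valuation.map_sum_lt _ one_ne_zero fun i hi => ?_
    rw [mem_Ico] at hi
    rw [coeff_C_mul_X_pow]
    split_ifs
    · exact hqsmall i hi.1 (by omega)
    · rw [map_zero]; exact zero_lt_one
  have hM'coeff : ∀ k, V.valuation ((derivative M).coeff k) < 1 := by
    intro k
    rw [coeff_derivative, map_mul]
    have hnat : V.valuation ((k : Ω) + 1) ≤ 1 := by
      rw [← Nat.cast_succ]
      exact (V.valuation_le_one_iff _).mpr (natCast_mem V (k + 1))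
    calc V.valuation (M.coeff (k + 1)) * V.valuation ((k : Ω) + 1)
        ≤ V.valuation (M.coeff (k + 1)) * 1 := mul_le_mul' le_rfl hnat
      _ < 1 := by rw [mul_one]; exact hMcoeff (k + 1)
  obtain ⟨m, hm⟩ : ∃ m : ℕ, N = m + 1 := Nat.exists_eq_succ_of_ne_zero hN.ne'
  have hGw₀ : V.valuation (G.eval w₀) < 1 := by
    have hev : G.eval w₀ = (w₀ ^ N + q 1 * w₀ ^ (N - 1)) + M.eval w₀ := by
      rw [hG]; simp only [eval_add, eval_mul, eval_C, eval_pow, eval_X]; ring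
    have hfirst : w₀ ^ N + q 1 * w₀ ^ (N - 1) = 0 := by
      rw [hq1, hm, Nat.add_sub_cancel, pow_succ]; ring
    rw [hev, hfirst, zero_add]
    exact valuation_eval_lt_one_of_coeff V hMcoeff hw₀V
  have hG'w₀ : V.valuation ((derivative G).eval w₀) = 1 := by
    have hev : (derivative G).eval w₀ =
        ((N : Ω) * w₀ ^ (N - 1) + q 1 * ((N - 1 : ℕ) : Ω) * w₀ ^ (N - 1 - 1)) +
          (derivative M).eval w₀ := by
      rw [hG, derivative_add, derivative_add, derivative_X_pow, derivative_C_mul_X_pow]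
      simp only [eval_add, eval_mul, eval_C, eval_pow, eval_X]
      ring
    have hfirst : (N : Ω) * w₀ ^ (N - 1) + q 1 * ((N - 1 : ℕ) : Ω) * w₀ ^ (N - 1 - 1) =
        w₀ ^ (N - 1) := by
      rw [hq1, hm, Nat.add_sub_cancel]
      rcases m with _ | k
      · simp
      · rw [Nat.add_sub_cancel]
        push_cast
        ring
    rw [hev, hfirst]
    have hsmall : V.valuation ((derivative M).eval w₀) < V.valuation (w₀ ^ (N - 1)) := by
      rw [map_pow, hvw₀, one_pow]
      exact valuation_eval_lt_one_of_coeff V hM'coeff hw₀V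
    rw [Valuation.map_add_eq_of_lt_left _ hsmall, map_pow, hvw₀, one_pow]
  /- Step 7: Hensel's Lemma in the henselian `L`: a root `w` of `G` near `w₀`; `ζ = w⁻¹` is a
  root of `F°`. -/
  obtain ⟨w, hwL, hwV, hGw, hww₀⟩ :=
    exists_root_of_isHenselianField V hL hGmon hGcoeff hw₀L hw₀V hGw₀ hG'w₀
  have hvw : V.valuation w = 1 := by
    rw [← hvw₀] at hww₀
    rw [Valuation.map_eq_of_sub_lt _ hww₀, hvw₀]
  have hw0 : w ≠ 0 := fun h0 => by rw [h0, map_zero] at hvw; exact zero_ne_one hvw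
  obtain ⟨ζ, hζ⟩ : ∃ ζ : Ω, ζ = w⁻¹ := ⟨_, rfl⟩
  have hζL : ζ ∈ L := by rw [hζ]; exact inv_mem hwL
  have hvζ : V.valuation ζ = 1 := by rw [hζ, map_inv₀, hvw, inv_one]
  have hζV : ζ ∈ V := (V.valuation_le_one_iff _).mp hvζ.le
  have hwζ : w * ζ = 1 := by rw [hζ, mul_inv_cancel₀ hw0]
  have hsumζ : ∑ i ∈ range (N + 1), a i * ζ ^ i = 0 := by
    have hGw' : w ^ N + ∑ i ∈ Ico 1 (N + 1), q i * w ^ (N - i) = 0 := by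
      rw [hGsum] at hGw
      simpa only [eval_add, eval_pow, eval_X, eval_finsetSum, eval_mul, eval_C] using hGw
    have key : ∑ i ∈ range (N + 1), a i * ζ ^ i =
        a 0 * ζ ^ N * (w ^ N + ∑ i ∈ Ico 1 (N + 1), q i * w ^ (N - i)) := by
      rw [hsplit, pow_zero, mul_one, mul_add, mul_sum]
      congr 1
      · rw [mul_assoc, ← mul_pow, mul_comm ζ w, hwζ, one_pow, mul_one]
      · refine sum_congr rfl fun i hi => ?_
        rw [mem_Ico] at hi
        have hpow : ζ ^ N * w ^ (N - i) = ζ ^ i := by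
          rw [← pow_sub_mul_pow ζ (show i ≤ N by omega), mul_assoc, mul_comm (ζ ^ i),
            ← mul_assoc (ζ ^ (N - i)), ← mul_pow, mul_comm ζ w, hwζ, one_pow, one_mul]
        calc a i * ζ ^ i = (a 0 * q i) * (ζ ^ N * w ^ (N - i)) := by rw [haq, hpow]
          _ = a 0 * ζ ^ N * (q i * w ^ (N - i)) := by ring
    rw [key, hGw', mul_zero]
  /- Step 8: `v(x̃ - ζ) = v(F°(x̃))`. -/
  -- `∑ a i (x̃^i - ζ^i) = (x̃ - ζ) · ∑ a i gᵢ` with `g₁ = 1`, `g₀ = 0`, `gᵢ ∈ V`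
  obtain ⟨gs, hgs⟩ : ∃ gs : ℕ → Ω, gs = fun i => ∑ j ∈ range i, xt ^ j * ζ ^ (i - 1 - j) :=
    ⟨_, rfl⟩
  have hgsi : ∀ i, gs i * (xt - ζ) = xt ^ i - ζ ^ i := fun i => by rw [hgs]; exact geom_sum₂_mul xt ζ i
  have hgsV : ∀ i, gs i ∈ V := fun i => by
    rw [hgs]
    exact sum_mem fun j _ => mul_mem (pow_mem hxtV j) (pow_mem hζV _)
  have hgs0 : gs 0 = 0 := by rw [hgs]; simp
  have hgs1 : gs 1 = 1 := by rw [hgs]; simp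
  have hdiff : ∑ i ∈ range (N + 1), a i * xt ^ i - ∑ i ∈ range (N + 1), a i * ζ ^ i =
      (xt - ζ) * ∑ i ∈ range (N + 1), a i * gs i := by
    rw [← sum_sub_distrib, mul_sum]
    refine sum_congr rfl fun i _ => ?_
    rw [← mul_sub, ← hgsi]
    ring
  have hvS : V.valuation (∑ i ∈ range (N + 1), a i * gs i) = 1 := by
    rw [hsplit, sum_eq_sum_Ico_succ_bot (by omega : 1 < N + 1), hgs0, hgs1, ha1, mul_zero,
      zero_add, mul_one]
    have hsmall : V.valuation (∑ i ∈ Ico 2 (N + 1), a i * gs i) < V.valuation (1 : Ω) := by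
      rw [map_one]
      refine Valuation.map_sum_lt _ one_ne_zero fun i hi => ?_
      rw [mem_Ico] at hi
      rw [map_mul]
      calc V.valuation (a i) * V.valuation (gs i) ≤ V.valuation (a i) * 1 :=
            mul_le_mul' le_rfl ((V.valuation_le_one_iff _).mpr (hgsV i))
        _ < 1 := by rw [mul_one]; exact hasmall i hi.1 (by omega)
    rw [Valuation.map_add_eq_of_lt_left _ hsmall, map_one]
  have hvxtζ : V.valuation (xt - ζ) * V.valuation b = V.valuation (f.eval x - y) := by
    have h1 := congrArg V.valuation hdiff
    rw [hsumζ, sub_zero, hsumx, map_mul, hvS, mul_one, map_div₀, hve] at h1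
    rw [← h1, div_mul_cancel₀ _ hvb0]
  /- Step 9: the approximant `ℓ = c + bζ`. -/
  refine ⟨c + b * ζ, add_mem (hKL hcK) (mul_mem (hKL hbK) hζL), le_of_eq ?_⟩
  have : x - (c + b * ζ) = b * (xt - ζ) := by rw [mul_sub, ← hxc]; ring
  rw [this, map_mul, mul_comm, hvxtζ]

end Literature.AlgebraicGeometry.Resolution

end
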